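import Summits.QuantumFields.BalabanUV.T4Continuum.Support.NE7CombSliceSourceDuality
import Summits.QuantumFields.BalabanUV.T4Continuum.Support.NE3DirIterMajorant
import HarnessLib

/-!
# NE7CutoffDirIterCommutator — THE COMMUTATOR LETTER `[D_W, χ]` OF THE TORUS ROAD (memo §8, brick (N2)′(a)): for a `W`-TANGENT direction `Y` (`D_W Y = 0`) and a
# bondwise real weight `c` (the cutoff), the linearised `(j+1)`-fold average of `c·Y` at a coarse bond is controlled by the OSCILLATION of `c` over the dependency
# ball of that bond times row NE3's majorant of `‖Y‖` — `‖D_W(c·Y)(z,κ)‖ ≤ osc·(majIter ‖Y‖ (z,κ) + frameMaj ‖Y‖ z + frameMaj ‖Y‖ (z+e_κ))` — so a cutoff varying on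
# scale `R·M` (`osc ≲ depRad∕(RM) ≲ nbRad∕R`) costs `1∕R`, at ANY background of the multi-level class and with no derivative of `Y`

Cell `pub-balaban`, rung (B)+1 sub-cell t4, lineage `b2b-balaban-t4-ne7-p1` (CRUX PROVER NE7 #1 = OWNER of row NE7), generation 88; memo
`t4/b2b-balaban-t4-ne7-p1-g88/EXISTENCE-BY-INDUCTION.md` §7 (T3), §8 (N2)′(a).  File F250 (over row NE3's `NE3DirIterMajorant.norm_dirIter_le_majorant_local` (the
LOCAL-hypothesis majorant: domination needed only on the two dependency balls of radius `depRad d L (j+1)`), `majIter_smul` ∕ `frameMaj_smul`, `dirIter_add`, and the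
lineage's `NE7CombSliceSourceDuality.dirIter_smul`).

WHY.  The criticality defect of the torus road pairs the Euler–Lagrange form with a cut-off flat-tangent test `χ̃Y` (F249: cost `c_R·‖D_U(χ̃Y)‖₁`); with `D_1 Y = 0` the
flat part of `D_U(χ̃Y)` is the commutator `D_1(χ̃Y) − χ̃·D_1Y = D_1(χ̃Y)`.  THIS FILE bounds it: subtract the constant `c₀` (the weight's value at the block) —
`D_W((c − c₀)·Y) = D_W(c·Y) − c₀·D_W Y = D_W(c·Y)` by linearity and tangency — and dominate `(c − c₀)·Y` by `osc·‖Y‖` ON THE DEPENDENCY BALLS ONLY, which is all row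
NE3's local majorant asks.
WHAT ([folklore]; 0 def, 0 sorry).
§1 **`norm_dirIter_weight_le_osc_majorant`** — `W` unitary `(L^{j+1}·M)`-periodic of the multi-level class at radius `x`, `Y` skew periodic with `D_W Y = 0`, `c` a real
   bond weight, `c₀ ∈ ℝ`, `osc ≥ 0` with `|c(y,μ) − c₀| ≤ osc` whenever `y` lies in the dependency ball of `L^{j+1}•z` or of `L^{j+1}•(z + e_κ)` ⟹
   `‖D_W(c·Y)(z,κ)‖ ≤ osc·(majIter d L (j+1) x ‖Y‖ z κ + frameMaj d L (j+1) x ‖Y‖ z + frameMaj d L (j+1) x ‖Y‖ (z + e_κ))`.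
§2 `norm_dirIter_weight_le_osc_majorant'` — the same with the weighted direction written `fun y μ => c y μ • Y y μ`.
(The period-box sums of the three majorants are row NE3's ∕ the lineage's `sum_periodBox_majIter_le`, `sum_periodBox_frameMaj_le` — `O((L∕L^d)^{j+1})·‖Y‖₁`.)
HONEST FRAMING (page 1): composition of tree theorems; nothing of Bałaban's asserted; NOT (APE), NOT ONE-STEP, NOT NE7; spine 0∕9; finite T⁴ rung (B)+1 — NOT infinite
volume, NOT mass gap, NOT `BetaPertH`, NOT Clay.  Continuum YM on T⁴ ⇐ BetaPertH ∧ nine spine estimates (0/9 proved); BetaPertH ⇐ (D1) ∧ (D4) ∧ CAP+tail; G-an2-4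
gates asym, D1 and NE2/3/4.
-/

set_option autoImplicit false

open scoped BigOperators Matrix.Norms.L2Operator
open NormedSpace Finset

namespace Summit.QuantumFields.BalabanUV.T4Continuum.NE7CutoffDirIterCommutator

open Literature.MathematicalPhysics.QuantumFieldTheory.Balaban1983to89
open B7Prop1Explicit B7Prop2Explicit
open T4AveragingDeficitWall (IsUnitaryCfg IsSkewDir SmallField)
open T4AveragingDeficitWallBoundary (IsPeriodicCfg)
open AveragingDeficitPeriodicCounting (IsPeriodicDir)
open AveragingDeficitMultiLevelPrep (LevelSmall tower)
open NE3TangentCovariantTower (dirIter dirIter_add)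
open NE3QbarIterMajorant (majIter majIter_smul)
open NE3DirIterMajorant (frameMaj frameMaj_smul norm_dirIter_le_majorant_local)
open NE3QuadRemainderLocality (depRad)
open NE7CombSliceSourceDuality (dirIter_smul)

noncomputable section

variable {d : ℕ} {n : Type*} [Fintype n] [DecidableEq n]

/-! ## §1 The commutator letter -/

/-- **`‖D_W(c·Y)(z,κ)‖ ≤ osc·(majIter ‖Y‖ + frameMaj ‖Y‖ z + frameMaj ‖Y‖ (z+e_κ))` FOR A `W`-TANGENT `Y`** (statement in the module docstring §1).  Proof:
`c·Y = (c − c₀)·Y + c₀·Y`, `D_W` is `ℝ`-linear (`dirIter_add`, `dirIter_smul`) and `D_W Y = 0`, so `D_W(c·Y) = D_W((c − c₀)·Y)`; on the two dependency balls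
`‖(c − c₀)·Y‖ ≤ osc·‖Y‖`, which is the local domination row NE3's `norm_dirIter_le_majorant_local` asks; `majIter`, `frameMaj` are homogeneous. [folklore] -/
theorem norm_dirIter_weight_le_osc_majorant [Nonempty n] {L M : ℕ} [NeZero M] (hL : 1 ≤ L) (j : ℕ)
    {W : Site d → Fin d → (Matrix n n ℂ)ˣ} {x : ℝ} (hWu : IsUnitaryCfg W) (hWP : IsPeriodicCfg W ((tower L M (j + 1) : ℕ) : ℤ))
    (hx : 0 ≤ x) (hs : LevelSmall d L j x) (hWx : SmallField W x)
    {Y : Site d → Fin d → Matrix n n ℂ} (hY : IsSkewDir Y) (hYP : IsPeriodicDir Y ((tower L M (j + 1) : ℕ) : ℤ))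
    (hYT : dirIter L (j + 1) W Y = 0)
    (c : Site d → Fin d → ℝ) (hcP : ∀ (y : Site d) (i : Fin d) (μ : Fin d), c (y + ((tower L M (j + 1) : ℕ) : ℤ) • e i) μ = c y μ)
    (z : Site d) (κ : Fin d) {c₀ osc : ℝ}
    (hosc : ∀ (y : Site d) (μ : Fin d), (l1 (y - ((L : ℤ) ^ (j + 1)) • z) ≤ depRad d L (j + 1)
      ∨ l1 (y - ((L : ℤ) ^ (j + 1)) • (z + e κ)) ≤ depRad d L (j + 1)) → |c y μ - c₀| ≤ osc) :
    ‖dirIter L (j + 1) W (fun y μ => (c y μ : ℂ) • Y y μ) z κ‖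
      ≤ osc * (majIter d L (j + 1) x (fun y μ => ‖Y y μ‖) z κ + frameMaj d L (j + 1) x (fun y μ => ‖Y y μ‖) z
          + frameMaj d L (j + 1) x (fun y μ => ‖Y y μ‖) (z + e κ)) := by
  -- the weighted direction minus the constant part
  set Z : Site d → Fin d → Matrix n n ℂ := fun y μ => ((c y μ - c₀ : ℝ) : ℂ) • Y y μ with hZ
  have hZs : IsSkewDir Z := fun y μ => by
    have : ((c y μ - c₀ : ℝ) : ℂ) • Y y μ = (c y μ - c₀) • Y y μ := (Complex.coe_smul _ _)
    rw [hZ]; simp only [this]; exact skewAdjoint.smul_mem _ (hY y μ)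
  have hZP : IsPeriodicDir Z ((tower L M (j + 1) : ℕ) : ℤ) := fun y i μ => by simp only [hZ, hYP y i μ, hcP y i μ]
  -- `c·Y = Z + c₀·Y` and linearity + tangency
  have hsplit : (fun y μ => (c y μ : ℂ) • Y y μ) = fun y μ => Z y μ + (c₀ • Y) y μ := by
    funext y μ
    simp only [hZ, Pi.smul_apply]
    rw [show (c₀ • Y y μ : Matrix n n ℂ) = ((c₀ : ℝ) : ℂ) • Y y μ from (Complex.coe_smul _ _).symm, ← add_smul]
    congr 1; push_cast; ring
  have hlin : dirIter L (j + 1) W (fun y μ => (c y μ : ℂ) • Y y μ) z κ = dirIter L (j + 1) W Z z κ := by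
    rw [hsplit, dirIter_add hL j hWu hx hs hWx Z (c₀ • Y)]
    simp only
    rw [dirIter_smul hL j hWu hx hs hWx c₀ Y, hYT]
    simp
  rw [hlin]
  -- local domination of `Z` by `osc·‖Y‖` on the two dependency balls
  have hdom : ∀ (y : Site d) (μ : Fin d), (l1 (y - ((L : ℤ) ^ (j + 1)) • z) ≤ depRad d L (j + 1)
      ∨ l1 (y - ((L : ℤ) ^ (j + 1)) • (z + e κ)) ≤ depRad d L (j + 1)) → ‖Z y μ‖ ≤ (fun y' μ' => osc * ‖Y y' μ'‖) y μ := by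
    intro y μ hy
    simp only [hZ]
    rw [norm_smul, Complex.norm_real, Real.norm_eq_abs]
    exact mul_le_mul_of_nonneg_right (hosc y μ hy) (norm_nonneg _)
  have h := norm_dirIter_le_majorant_local (M := M) hL j hWu hWP hx hs hWx hZs hZP z κ hdom
  rw [majIter_smul, frameMaj_smul, frameMaj_smul] at h
  simp only at h
  linarith

/-! ## §2 The same letter for the `ℝ`-weighted spelling -/

/-- The commutator letter with the weighted direction spelled `fun y μ => c y μ • Y y μ` (real scalar action). [folklore] -/
theorem norm_dirIter_weight_le_osc_majorant' [Nonempty n] {L M : ℕ} [NeZero M] (hL : 1 ≤ L) (j : ℕ)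
    {W : Site d → Fin d → (Matrix n n ℂ)ˣ} {x : ℝ} (hWu : IsUnitaryCfg W) (hWP : IsPeriodicCfg W ((tower L M (j + 1) : ℕ) : ℤ))
    (hx : 0 ≤ x) (hs : LevelSmall d L j x) (hWx : SmallField W x)
    {Y : Site d → Fin d → Matrix n n ℂ} (hY : IsSkewDir Y) (hYP : IsPeriodicDir Y ((tower L M (j + 1) : ℕ) : ℤ))
    (hYT : dirIter L (j + 1) W Y = 0)
    (c : Site d → Fin d → ℝ) (hcP : ∀ (y : Site d) (i : Fin d) (μ : Fin d), c (y + ((tower L M (j + 1) : ℕ) : ℤ) • e i) μ = c y μ)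
    (z : Site d) (κ : Fin d) {c₀ osc : ℝ}
    (hosc : ∀ (y : Site d) (μ : Fin d), (l1 (y - ((L : ℤ) ^ (j + 1)) • z) ≤ depRad d L (j + 1)
      ∨ l1 (y - ((L : ℤ) ^ (j + 1)) • (z + e κ)) ≤ depRad d L (j + 1)) → |c y μ - c₀| ≤ osc) :
    ‖dirIter L (j + 1) W (fun y μ => c y μ • Y y μ) z κ‖
      ≤ osc * (majIter d L (j + 1) x (fun y μ => ‖Y y μ‖) z κ + frameMaj d L (j + 1) x (fun y μ => ‖Y y μ‖) z
          + frameMaj d L (j + 1) x (fun y μ => ‖Y y μ‖) (z + e κ)) := by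
  have hsp : (fun y μ => c y μ • Y y μ) = fun y μ => (c y μ : ℂ) • Y y μ := by
    funext y μ; exact (Complex.coe_smul _ _).symm
  rw [hsp]
  exact norm_dirIter_weight_le_osc_majorant hL j hWu hWP hx hs hWx hY hYP hYT c hcP z κ hosc

end

end Summit.QuantumFields.BalabanUV.T4Continuum.NE7CutoffDirIterCommutator
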